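import Literature.Analysis.FluidPDE.NSFourierFamily
import Mathlib.Analysis.Fourier.FourierTransformDeriv
import Mathlib.Analysis.Calculus.ContDiff.FiniteDimension
import HarnessLib

/-!
# Synthesis: joint smoothness of `(t, x) ↦ 𝓕 W₀(t)(x)` on the closed slab

Sixth file of the Fourier-side construction of Leray's local regular solution
(`Literature.Analysis.FluidPDE.local_regular_solution_exists` in `NSLocalRegular`, the existence half of the named fact
`Literature.Analysis.FluidPDE.local_classical_lerayHopf`). For a Fourier family
`W₀, …, W_n` on `[0, T]` (`IsFourierFamily`, file `NSFourierFamily`) the synthesized field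

  `synth W (t, x) = 𝓕 (W₀ t) x = ∫ 𝐞(-⟪ξ, x⟫) W₀(t, ξ) dξ`

is `C^n` **jointly** in `(t, x)` on the closed slab `[0, T] × E`, one-sided in `t` at the
endpoints (`contDiffOn_synth`), and the derivatives are again synthesized fields:
`∂ₜ synth W = synth (W₁, W₂, …)` and `∂_h synth W = synth (-2πi⟪ξ, h⟫ W)` (`hasFDerivWithinAt_synth`,
`fderivWithin_synth_apply`). The proof is an induction on `n` over all families
(`contDiffOn_succ_iff_fderiv_apply` on the finite-dimensional domain `ℝ × E`): the joint Fréchet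
derivative within the slab is obtained by differentiating under the integral sign
(`hasFDerivAt_integral_of_dominated_of_fderiv_le`) the integrand extended in `t` off `[0, T]`
by tangent lines (`icExtend`), which is `C¹` by `hasDerivAt_icExtend`.

This is the Fourier-side form of Leray's "the derivatives of a regular solution exist and are
continuous on the closed time interval" (Leray 1934, pp. 220–221; Ożański–Pooley 2018, remark
after Def. 6.20 and Cor. 6.16); Mathlib provides the `x`-regularity of Fourier integrals
(`Real.contDiff_fourier`) but not the joint, one-sided-in-time statement.

## Mathlib search

`Real.fourier_eq`, `Real.hasFDerivAt_fourierChar_neg_bilinear_right`,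
`hasFDerivAt_integral_of_dominated_of_fderiv_le`, `contDiffOn_succ_iff_fderiv_apply`,
`contDiffOn_infty`, `ContinuousLinearMap.integral_apply`, `continuousOn_of_dominated`.

## References

* J. Leray, Acta Math. 63 (1934), §19, pp. 220–221. [Leray1934]
* W. S. Ożański, B. C. Pooley, LMS LN 452, CUP 2018, Def. 6.20, Cor. 6.16. [OzanskiPooley2018]
-/

noncomputable section

open MeasureTheory Real Set Filter Topology Function Complex
open scoped FourierTransform RealInnerProductSpace ContDiff

namespace Literature.Analysis.FluidPDE.FourierNS

variable {ι : Type*} [Fintype ι]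

/-- The synthesized field of a Fourier family: `synth W (t, x) = 𝓕 (W₀ t) x`. [folklore] -/
def synth (W : ℕ → ℝ → EuclideanSpace ℝ ι → ℂ) (z : ℝ × EuclideanSpace ℝ ι) : ℂ :=
  𝓕 (W 0 z.1) z.2

/-- Unfolding `synth` as a Fourier integral (Mathlib `Real.fourier_eq`). [folklore] -/
theorem synth_eq (W : ℕ → ℝ → EuclideanSpace ℝ ι → ℂ) (z : ℝ × EuclideanSpace ℝ ι) :
    synth W z = ∫ ξ, 𝐞 (-⟪ξ, z.2⟫) • W 0 z.1 ξ := by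
  rw [synth, Real.fourier_eq]

/-- The space-derivative symbol family `-2πi⟪ξ, h⟫ W`. [folklore] -/
def dmul (h : EuclideanSpace ℝ ι) (W : ℕ → ℝ → EuclideanSpace ℝ ι → ℂ) :
    ℕ → ℝ → EuclideanSpace ℝ ι → ℂ :=
  fun k t ξ => (-(2 * π * I) * (⟪ξ, h⟫ : ℂ)) * W k t ξ

variable {T : ℝ} {n : ℕ} {W : ℕ → ℝ → EuclideanSpace ℝ ι → ℂ}

/-- The symbol `-2πi⟪ξ, h⟫` has linear growth `≤ 2π‖h‖(1 + ‖ξ‖)`. [folklore] -/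
theorem norm_dmulSymbol_le (h ξ : EuclideanSpace ℝ ι) :
    ‖-(2 * π * I) * (⟪ξ, h⟫ : ℂ)‖ ≤ 2 * π * ‖h‖ * (1 + ‖ξ‖) ^ 1 := by
  simp only [norm_mul, norm_neg, Complex.norm_two, Complex.norm_real, Complex.norm_I, mul_one,
    Real.norm_eq_abs, abs_of_pos Real.pi_pos, pow_one]
  have := abs_real_inner_le_norm ξ h
  have hπ := Real.pi_pos
  nlinarith [norm_nonneg ξ, norm_nonneg h]

/-- The space-derivative family of a family is a family (of the same order). [folklore] -/
theorem IsFourierFamily.dmul (hW : IsFourierFamily T n W) (h : EuclideanSpace ℝ ι) :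
    IsFourierFamily T n (dmul h W) :=
  hW.symbol (m := fun ξ => -(2 * π * I) * (⟪ξ, h⟫ : ℂ))
    (by fun_prop : Continuous fun ξ : EuclideanSpace ℝ ι => -(2 * π * I) * (⟪ξ, h⟫ : ℂ)).aestronglyMeasurable
    (d := 1) (M := 2 * π * ‖h‖) (by positivity) (norm_dmulSymbol_le h)

/-- `dmul 0 W = 0`: no derivative in the zero direction. [folklore] -/
theorem synth_dmul_zero (W : ℕ → ℝ → EuclideanSpace ℝ ι → ℂ) (z : ℝ × EuclideanSpace ℝ ι) :
    synth (dmul 0 W) z = 0 := by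
  rw [synth_eq]
  simp [dmul]

/-! ### Continuity on the slab -/

/-- **Joint continuity** of the synthesized field on the closed slab `[0, T] × E` for a family
of order `0` (dominated convergence: the integrand is dominated by the uniform order-`K₀` decay
bound). [folklore] -/
theorem continuousOn_synth (hW : IsFourierFamily T n W) :
    ContinuousOn (synth W) (Icc 0 T ×ˢ univ) := by
  set K₀ := Fintype.card ι + 1
  have hK₀ : Fintype.card ι < K₀ := card_lt_succ
  obtain ⟨C, hC⟩ := hW.decay 0 (Nat.zero_le _) K₀
  have hsynth : synth W = fun z => ∫ ξ, 𝐞 (-⟪ξ, z.2⟫) • W 0 z.1 ξ := funext (synth_eq W)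
  rw [hsynth]
  refine continuousOn_of_dominated (bound := fun ξ => C * ((1 + ‖ξ‖) ^ K₀)⁻¹) ?_ ?_ ?_ ?_
  · intro z hz
    exact (Continuous.aestronglyMeasurable (by fun_prop)).smul (hW.meas 0 (Nat.zero_le _) z.1 hz.1)
  · intro z hz
    refine Eventually.of_forall fun ξ => ?_
    rw [Circle.norm_smul]
    exact hC z.1 hz.1 ξ
  · exact (integrable_inv_one_add_norm_pow (finrank_lt_of_card_lt hK₀)).const_mul C
  · refine Eventually.of_forall fun ξ => ?_
    have h1 : Continuous fun z : ℝ × EuclideanSpace ℝ ι => (𝐞 (-⟪ξ, z.2⟫) : ℂ) := by fun_prop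
    have h2 : ContinuousOn (fun z : ℝ × EuclideanSpace ℝ ι => W 0 z.1 ξ) (Icc 0 T ×ˢ univ) :=
      (hW.cont 0 (Nat.zero_le _) ξ).comp continuous_fst.continuousOn fun z hz => hz.1
    simp only [Circle.smul_def, smul_eq_mul]
    exact h1.continuousOn.mul h2

/-! ### The joint derivative within the slab -/

/-- The `x`-derivative of the character `x ↦ 𝐞(-⟪ξ, x⟫)` as a continuous linear map:
`h ↦ (-⟪ξ, h⟫) • (2πi 𝐞(-⟪ξ, x⟫))` (chain rule with Mathlib `Real.hasDerivAt_fourierChar`). [folklore] -/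
def charDeriv (ξ x : EuclideanSpace ℝ ι) : EuclideanSpace ℝ ι →L[ℝ] ℂ :=
  (ContinuousLinearMap.smulRight (1 : ℝ →L[ℝ] ℝ) (2 * π * I * (𝐞 (-⟪ξ, x⟫) : ℂ))).comp
    (-(innerSL ℝ ξ))

/-- Evaluation of `charDeriv`. [folklore] -/
theorem charDeriv_apply (ξ x h : EuclideanSpace ℝ ι) :
    charDeriv ξ x h = -2 * π * I * 𝐞 (-⟪ξ, x⟫) * (⟪ξ, h⟫ : ℂ) := by
  simp only [charDeriv, ContinuousLinearMap.comp_apply, neg_apply,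
    innerSL_apply_apply, ContinuousLinearMap.smulRight_apply, one_apply_eq_self,
    Complex.real_smul, Complex.ofReal_neg]
  ring

/-- The character has derivative `charDeriv ξ x` at `x`. [folklore] -/
theorem hasFDerivAt_char (ξ x : EuclideanSpace ℝ ι) :
    HasFDerivAt (fun x : EuclideanSpace ℝ ι => (𝐞 (-⟪ξ, x⟫) : ℂ)) (charDeriv ξ x) x := by
  have h1 : HasFDerivAt (fun y : EuclideanSpace ℝ ι => -⟪ξ, y⟫) (-(innerSL ℝ ξ)) x := by
    have := (innerSL ℝ ξ).hasFDerivAt (x := x)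
    exact this.neg
  exact (Real.hasDerivAt_fourierChar (-⟪ξ, x⟫)).hasFDerivAt.comp x h1

/-- `ξ ↦ charDeriv ξ x` is continuous (needed for measurability of the derivative integrand). [folklore] -/
theorem continuous_charDeriv (x : EuclideanSpace ℝ ι) : Continuous fun ξ => charDeriv ξ x := by
  unfold charDeriv
  have hc : Continuous fun ξ : EuclideanSpace ℝ ι => 2 * π * I * (𝐞 (-⟪ξ, x⟫) : ℂ) := by fun_prop
  have h1 : Continuous fun ξ : EuclideanSpace ℝ ι =>
      ContinuousLinearMap.smulRight (1 : ℝ →L[ℝ] ℝ) (2 * π * I * (𝐞 (-⟪ξ, x⟫) : ℂ)) :=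
    (ContinuousLinearMap.smulRightL ℝ ℝ ℂ (1 : ℝ →L[ℝ] ℝ)).continuous.comp hc
  have h2 : Continuous fun ξ : EuclideanSpace ℝ ι => -(innerSL ℝ ξ) := (innerSL ℝ).continuous.neg
  exact h1.clm_comp h2

/-- Norm bound `‖charDeriv ξ x h‖ ≤ 2π‖ξ‖‖h‖`. [folklore] -/
theorem norm_charDeriv_apply_le (ξ x h : EuclideanSpace ℝ ι) :
    ‖charDeriv ξ x h‖ ≤ 2 * π * ‖ξ‖ * ‖h‖ := by
  rw [charDeriv_apply]
  simp only [norm_mul, norm_neg, Complex.norm_two, Complex.norm_real, Complex.norm_I, mul_one,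
    Circle.norm_coe, Real.norm_eq_abs, abs_of_pos Real.pi_pos]
  have := abs_real_inner_le_norm ξ h
  have hπ := Real.pi_pos
  nlinarith [norm_nonneg ξ, norm_nonneg h]

/-- The candidate joint derivative of the (extended) Fourier integrand at `(t, x)` and
frequency `ξ`: `y ↦ y.1 • (𝐞 W') + (W · charDeriv) y.2`. [folklore] -/
def synthDerivCLM (c W W' : ℂ) (ξ x : EuclideanSpace ℝ ι) : ℝ × EuclideanSpace ℝ ι →L[ℝ] ℂ :=
  (ContinuousLinearMap.fst ℝ ℝ (EuclideanSpace ℝ ι)).smulRight (c * W') +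
    W • ((charDeriv ξ x).comp (ContinuousLinearMap.snd ℝ ℝ (EuclideanSpace ℝ ι)))

/-- Evaluation of `synthDerivCLM`. [folklore] -/
theorem synthDerivCLM_apply (c W W' : ℂ) (ξ x : EuclideanSpace ℝ ι) (y : ℝ × EuclideanSpace ℝ ι) :
    synthDerivCLM c W W' ξ x y = (y.1 : ℂ) * (c * W') + W * charDeriv ξ x y.2 := by
  simp [synthDerivCLM, Complex.real_smul, smul_eq_mul]

/-- Operator-norm bound for `synthDerivCLM` with `‖c‖ = 1`. [folklore] -/
theorem norm_synthDerivCLM_le {c W W' : ℂ} (hc : ‖c‖ = 1) (ξ x : EuclideanSpace ℝ ι) :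
    ‖synthDerivCLM c W W' ξ x‖ ≤ ‖W'‖ + 2 * π * ‖ξ‖ * ‖W‖ := by
  refine ContinuousLinearMap.opNorm_le_bound _ (by positivity) fun y => ?_
  rw [synthDerivCLM_apply]
  have h1 : ‖(y.1 : ℂ) * (c * W')‖ ≤ ‖W'‖ * ‖y‖ := by
    rw [norm_mul, norm_mul, hc, one_mul, Complex.norm_real, mul_comm]
    exact mul_le_mul_of_nonneg_left (norm_fst_le y) (norm_nonneg _)
  have h2 : ‖W * charDeriv ξ x y.2‖ ≤ 2 * π * ‖ξ‖ * ‖W‖ * ‖y‖ := by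
    rw [norm_mul]
    calc ‖W‖ * ‖charDeriv ξ x y.2‖ ≤ ‖W‖ * (2 * π * ‖ξ‖ * ‖y.2‖) :=
          mul_le_mul_of_nonneg_left (norm_charDeriv_apply_le ξ x y.2) (norm_nonneg _)
      _ ≤ ‖W‖ * (2 * π * ‖ξ‖ * ‖y‖) := by gcongr; exact norm_snd_le y
      _ = 2 * π * ‖ξ‖ * ‖W‖ * ‖y‖ := by ring
  calc ‖(y.1 : ℂ) * (c * W') + W * charDeriv ξ x y.2‖
      ≤ ‖(y.1 : ℂ) * (c * W')‖ + ‖W * charDeriv ξ x y.2‖ := norm_add_le _ _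
    _ ≤ ‖W'‖ * ‖y‖ + 2 * π * ‖ξ‖ * ‖W‖ * ‖y‖ := add_le_add h1 h2
    _ = (‖W'‖ + 2 * π * ‖ξ‖ * ‖W‖) * ‖y‖ := by ring

/-- Product rule for the extended integrand `z ↦ 𝐞(-⟪ξ, z.2⟫) k(z.1)` with `k` differentiable
in `t`. [folklore] -/
theorem hasFDerivAt_char_mul {k : ℝ → ℂ} {k' : ℂ} (ξ : EuclideanSpace ℝ ι)
    (z : ℝ × EuclideanSpace ℝ ι) (hk : HasDerivAt k k' z.1) :
    HasFDerivAt (fun zz : ℝ × EuclideanSpace ℝ ι => (𝐞 (-⟪ξ, zz.2⟫) : ℂ) * k zz.1)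
      (synthDerivCLM (𝐞 (-⟪ξ, z.2⟫)) (k z.1) k' ξ z.2) z := by
  have hc : HasFDerivAt (fun zz : ℝ × EuclideanSpace ℝ ι => (𝐞 (-⟪ξ, zz.2⟫) : ℂ))
      ((charDeriv ξ z.2).comp (ContinuousLinearMap.snd ℝ ℝ (EuclideanSpace ℝ ι))) z :=
    (hasFDerivAt_char ξ z.2).comp z hasFDerivAt_snd
  have hd : HasFDerivAt (fun zz : ℝ × EuclideanSpace ℝ ι => k zz.1)
      ((ContinuousLinearMap.smulRight (1 : ℝ →L[ℝ] ℝ) k').comp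
        (ContinuousLinearMap.fst ℝ ℝ (EuclideanSpace ℝ ι))) z :=
    hk.hasFDerivAt.comp z hasFDerivAt_fst
  have h := hc.mul hd
  refine h.congr_fderiv ?_
  ext y <;> simp [synthDerivCLM_apply, smul_eq_mul]

/-- `|t - clamp T t| ≤ |t - t₀|` for `t₀ ∈ [0, T]` (the clamp is a `1`-Lipschitz retraction). [folklore] -/
theorem abs_sub_clamp_le {t t₀ : ℝ} (hT : 0 ≤ T) (ht₀ : t₀ ∈ Icc 0 T) :
    |t - clamp T t| ≤ |t - t₀| := by
  rcases le_total t 0 with h0 | h0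
  · have : clamp T t = 0 := by simp [clamp, min_eq_left (h0.trans hT), max_eq_left h0]
    rw [this, sub_zero, abs_of_nonpos h0, abs_of_nonpos (by linarith [ht₀.1])]
    linarith [ht₀.1]
  rcases le_total t T with h1 | h1
  · rw [clamp_of_mem ⟨h0, h1⟩, sub_self, abs_zero]; exact abs_nonneg _
  · have : clamp T t = T := by simp [clamp, min_eq_right h1, max_eq_right hT]
    rw [this, abs_of_nonneg (by linarith), abs_of_nonneg (by linarith [ht₀.2])]
    linarith [ht₀.2]

-- the dominated-differentiation step elaborates many continuous-linear-map coercions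
set_option maxHeartbeats 800000 in
/-- **The joint derivative within the slab.** For a family of order `≥ 1` and
`z = (t, x) ∈ [0, T] × E`, the synthesized field has, within the slab, the Fréchet derivative
`L = ∫ synthDerivCLM (𝐞(-⟪ξ,x⟫)) (W₀ t ξ) (W₁ t ξ) ξ x dξ`, and
`L y = y.1 • synth (W₁, …) z + synth (dmul y.2 W) z` (differentiation under the integral sign
of the tangent-line extension in `t`; Leray 1934, pp. 220–221). [folklore] -/
theorem hasFDerivWithinAt_synth (hT : 0 < T) (hW : IsFourierFamily T (n + 1) W)
    {z : ℝ × EuclideanSpace ℝ ι} (hz : z ∈ Icc 0 T ×ˢ univ) :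
    ∃ L : ℝ × EuclideanSpace ℝ ι →L[ℝ] ℂ,
      HasFDerivWithinAt (synth W) L (Icc 0 T ×ˢ univ) z ∧
      ∀ y, L y = (y.1 : ℂ) * synth (fun k => W (k + 1)) z + synth (dmul y.2 W) z := by
  set K₀ := Fintype.card ι + 1 with hK₀def
  have hK₀ : Fintype.card ι < K₀ := card_lt_succ
  have ht₀ : z.1 ∈ Icc 0 T := hz.1
  have h0 : 0 ≤ n + 1 := Nat.zero_le _
  have h1 : 1 ≤ n + 1 := by omega
  -- decay constants (order `K₀` and `K₀ + 1`) of `W₀`, `W₁` on `[0, T]`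
  obtain ⟨C₀, hC₀⟩ := hW.decay 0 h0 K₀
  obtain ⟨C₀', hC₀'⟩ := hW.decay 0 h0 (1 + K₀)
  obtain ⟨C₁, hC₁⟩ := hW.decay 1 h1 K₀
  obtain ⟨C₁', hC₁'⟩ := hW.decay 1 h1 (1 + K₀)
  have hC₀0 : 0 ≤ C₀ := (hC₀ z.1 ht₀).nonneg
  have hC₁0 : 0 ≤ C₁ := (hC₁ z.1 ht₀).nonneg
  have hC₀'0 : 0 ≤ C₀' := (hC₀' z.1 ht₀).nonneg
  have hC₁'0 : 0 ≤ C₁' := (hC₁' z.1 ht₀).nonneg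
  -- the extended coefficient and its time derivative
  set Wt : ℝ → EuclideanSpace ℝ ι → ℂ := fun t ξ => icExtend T (W 0 · ξ) (W 1 · ξ) t with hWt
  set Wt' : ℝ → EuclideanSpace ℝ ι → ℂ := fun t ξ => W 1 (clamp T t) ξ with hWt'
  have hWt_deriv : ∀ ξ t, HasDerivAt (Wt · ξ) (Wt' t ξ) t := fun ξ t =>
    hasDerivAt_icExtend hT (fun s hs => by simpa using hW.deriv 0 (by omega) ξ s hs) t
  -- the integrands
  set F : ℝ × EuclideanSpace ℝ ι → EuclideanSpace ℝ ι → ℂ :=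
    fun zz ξ => (𝐞 (-⟪ξ, zz.2⟫) : ℂ) * Wt zz.1 ξ with hF
  set F' : ℝ × EuclideanSpace ℝ ι → EuclideanSpace ℝ ι → (ℝ × EuclideanSpace ℝ ι →L[ℝ] ℂ) :=
    fun zz ξ => synthDerivCLM (𝐞 (-⟪ξ, zz.2⟫)) (Wt zz.1 ξ) (Wt' zz.1 ξ) ξ zz.2 with hF'
  have hF_diff : ∀ ξ zz, HasFDerivAt (F · ξ) (F' zz ξ) zz := fun ξ zz =>
    hasFDerivAt_char_mul ξ zz (hWt_deriv ξ zz.1)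
  -- measurability of the slices
  have hWt_eq : ∀ t, (fun ξ => Wt t ξ) = W 0 (clamp T t) + (t - clamp T t) • W 1 (clamp T t) :=
    fun t => rfl
  have hWt_meas : ∀ t, AEStronglyMeasurable (fun ξ => Wt t ξ) volume := fun t => by
    rw [hWt_eq]
    exact (hW.meas 0 h0 _ (clamp_mem_Icc hT.le t)).add
      ((hW.meas 1 h1 _ (clamp_mem_Icc hT.le t)).const_smul _)
  have hWt'_meas : ∀ t, AEStronglyMeasurable (fun ξ => Wt' t ξ) volume := fun t =>
    hW.meas 1 h1 _ (clamp_mem_Icc hT.le t)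
  have hchar_cont : ∀ x : EuclideanSpace ℝ ι, Continuous fun ξ : EuclideanSpace ℝ ι =>
      (𝐞 (-⟪ξ, x⟫) : ℂ) := fun x => by fun_prop
  have hF_meas : ∀ zz, AEStronglyMeasurable (F zz) volume := fun zz =>
    (hchar_cont zz.2).aestronglyMeasurable.mul (hWt_meas zz.1)
  have hF'_meas : ∀ zz, AEStronglyMeasurable (F' zz) volume := by
    intro zz
    simp only [hF', synthDerivCLM]
    refine AEStronglyMeasurable.add ?_ ?_
    · have hsm : Continuous fun w : ℂ => (ContinuousLinearMap.fst ℝ ℝ (EuclideanSpace ℝ ι)).smulRight w :=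
        (ContinuousLinearMap.smulRightL ℝ (ℝ × EuclideanSpace ℝ ι) ℂ
          (ContinuousLinearMap.fst ℝ ℝ (EuclideanSpace ℝ ι))).continuous
      exact hsm.comp_aestronglyMeasurable ((hchar_cont zz.2).aestronglyMeasurable.mul (hWt'_meas zz.1))
    · exact (hWt_meas zz.1).smul (((ContinuousLinearMap.compL ℝ (ℝ × EuclideanSpace ℝ ι)
        (EuclideanSpace ℝ ι) ℂ).flip (ContinuousLinearMap.snd ℝ ℝ (EuclideanSpace ℝ ι))).continuous.comp
          (continuous_charDeriv zz.2)).aestronglyMeasurable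
  -- integrability at `z`
  have hFz : F z = fun ξ => (𝐞 (-⟪ξ, z.2⟫) : ℂ) * W 0 z.1 ξ := by
    funext ξ; simp only [hF, hWt, icExtend_of_mem ht₀]
  have hF_int : Integrable (F z) := by
    rw [hFz]
    refine ((hC₀ z.1 ht₀).integrable (finrank_lt_of_card_lt hK₀) (hW.meas 0 h0 z.1 ht₀)).norm.mono'
      (hF_meas z |>.congr (Eventually.of_forall fun ξ => by simp only [hFz])) ?_
    exact Eventually.of_forall fun ξ => by rw [norm_mul, Circle.norm_coe, one_mul]
  -- the dominating function on the unit ball around `z`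
  set bound : EuclideanSpace ℝ ι → ℝ := fun ξ =>
    (C₁ + 2 * π * ((C₀' + C₁') )) * ((1 + ‖ξ‖) ^ K₀)⁻¹ with hbound
  have hbound_int : Integrable bound :=
    (integrable_inv_one_add_norm_pow (finrank_lt_of_card_lt hK₀)).const_mul _
  have h_bound : ∀ᵐ ξ ∂volume, ∀ zz ∈ Metric.ball z 1, ‖F' zz ξ‖ ≤ bound ξ := by
    refine Eventually.of_forall fun ξ zz hzz => ?_
    have hcl := clamp_mem_Icc hT.le zz.1
    have hdt : |zz.1 - clamp T zz.1| ≤ 1 := by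
      refine (abs_sub_clamp_le hT.le ht₀).trans ?_
      have : dist zz.1 z.1 ≤ dist zz z := by
        rw [dist_eq_norm, dist_eq_norm]
        exact norm_fst_le (zz - z)
      rw [Real.dist_eq] at this
      exact this.trans (Metric.mem_ball.1 hzz).le
    -- bounds on `Wt`, `Wt'`
    have hWt'_le : ‖Wt' zz.1 ξ‖ ≤ C₁ * ((1 + ‖ξ‖) ^ K₀)⁻¹ := hC₁ _ hcl ξ
    have hWt_le : ‖ξ‖ * ‖Wt zz.1 ξ‖ ≤ (C₀' + C₁') * ((1 + ‖ξ‖) ^ K₀)⁻¹ := by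
      have e1 : ‖Wt zz.1 ξ‖ ≤ ‖W 0 (clamp T zz.1) ξ‖ + ‖W 1 (clamp T zz.1) ξ‖ := by
        change ‖W 0 (clamp T zz.1) ξ + (zz.1 - clamp T zz.1) • W 1 (clamp T zz.1) ξ‖ ≤ _
        refine (norm_add_le _ _).trans (add_le_add le_rfl ?_)
        rw [norm_smul, Real.norm_eq_abs]
        exact mul_le_of_le_one_left (norm_nonneg _) hdt
      have e2 := (hC₀' _ hcl).pow_mul_norm_le (n := 1) (K := K₀) ξ
      have e3 := (hC₁' _ hcl).pow_mul_norm_le (n := 1) (K := K₀) ξ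
      rw [pow_one] at e2 e3
      calc ‖ξ‖ * ‖Wt zz.1 ξ‖ ≤ ‖ξ‖ * (‖W 0 (clamp T zz.1) ξ‖ + ‖W 1 (clamp T zz.1) ξ‖) :=
            mul_le_mul_of_nonneg_left e1 (norm_nonneg _)
        _ = ‖ξ‖ * ‖W 0 (clamp T zz.1) ξ‖ + ‖ξ‖ * ‖W 1 (clamp T zz.1) ξ‖ := by ring
        _ ≤ C₀' * ((1 + ‖ξ‖) ^ K₀)⁻¹ + C₁' * ((1 + ‖ξ‖) ^ K₀)⁻¹ := add_le_add e2 e3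
        _ = (C₀' + C₁') * ((1 + ‖ξ‖) ^ K₀)⁻¹ := by ring
    calc ‖F' zz ξ‖ ≤ ‖Wt' zz.1 ξ‖ + 2 * π * ‖ξ‖ * ‖Wt zz.1 ξ‖ :=
          norm_synthDerivCLM_le (Circle.norm_coe _) ξ zz.2
      _ = ‖Wt' zz.1 ξ‖ + 2 * π * (‖ξ‖ * ‖Wt zz.1 ξ‖) := by ring
      _ ≤ C₁ * ((1 + ‖ξ‖) ^ K₀)⁻¹ + 2 * π * ((C₀' + C₁') * ((1 + ‖ξ‖) ^ K₀)⁻¹) := by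
          gcongr
      _ = bound ξ := by simp only [hbound]; ring
  -- differentiate under the integral sign
  have hmain := hasFDerivAt_integral_of_dominated_of_fderiv_le (μ := (volume : Measure (EuclideanSpace ℝ ι)))
    (F := F) (F' := F') (x₀ := z) (s := Metric.ball z 1) (Metric.ball_mem_nhds z one_pos)
    (Eventually.of_forall hF_meas) hF_int (hF'_meas z) h_bound hbound_int
    (Eventually.of_forall fun ξ zz _ => hF_diff ξ zz)
  -- integrability of `F' z` and evaluation of the derivative
  have hF'_int : Integrable (F' z) :=
    hbound_int.mono' (hF'_meas z) (h_bound.mono fun ξ hξ => hξ z (Metric.mem_ball_self one_pos))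
  refine ⟨∫ ξ, F' z ξ, ?_, fun y => ?_⟩
  · -- restrict to the slab, where `∫ F zz = synth W zz`
    refine hmain.hasFDerivWithinAt.congr (fun zz hzz => ?_) ?_
    · rw [synth_eq]
      refine integral_congr_ae (Eventually.of_forall fun ξ => ?_)
      simp only [hF, hWt, icExtend_of_mem (show zz.1 ∈ Icc 0 T from hzz.1), Circle.smul_def,
        smul_eq_mul]
    · rw [synth_eq]
      refine integral_congr_ae (Eventually.of_forall fun ξ => ?_)
      simp only [hF, hWt, icExtend_of_mem ht₀, Circle.smul_def, smul_eq_mul]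
  · rw [ContinuousLinearMap.integral_apply hF'_int y, synth_eq, synth_eq]
    have hWt_z : ∀ ξ, Wt z.1 ξ = W 0 z.1 ξ := fun ξ => by simp only [hWt, icExtend_of_mem ht₀]
    have hWt'_z : ∀ ξ, Wt' z.1 ξ = W 1 z.1 ξ := fun ξ => by simp only [hWt', clamp_of_mem ht₀]
    have hi1 : Integrable fun ξ => 𝐞 (-⟪ξ, z.2⟫) • W (0 + 1) z.1 ξ := by
      refine ((hC₁ z.1 ht₀).integrable (finrank_lt_of_card_lt hK₀) (hW.meas 1 h1 z.1 ht₀)).norm.mono'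
        ((hchar_cont z.2).aestronglyMeasurable.smul (hW.meas 1 h1 z.1 ht₀)) ?_
      exact Eventually.of_forall fun ξ => by rw [Circle.norm_smul]
    have hdm := hW.dmul y.2
    obtain ⟨Cd, hCd⟩ := hdm.decay 0 h0 K₀
    have hi2 : Integrable fun ξ => 𝐞 (-⟪ξ, z.2⟫) • FourierNS.dmul y.2 W 0 z.1 ξ := by
      refine ((hCd z.1 ht₀).integrable (finrank_lt_of_card_lt hK₀) (hdm.meas 0 h0 z.1 ht₀)).norm.mono'
        ((hchar_cont z.2).aestronglyMeasurable.smul (hdm.meas 0 h0 z.1 ht₀)) ?_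
      exact Eventually.of_forall fun ξ => by rw [Circle.norm_smul]
    rw [← integral_const_mul, ← integral_add (hi1.const_mul _) hi2]
    refine integral_congr_ae (Eventually.of_forall fun ξ => ?_)
    simp only [hF', synthDerivCLM_apply, hWt_z, hWt'_z, charDeriv_apply, FourierNS.dmul,
      Circle.smul_def, smul_eq_mul, zero_add]
    ring

/-! ### Smoothness by induction on the order -/

/-- The slab `[0, T] × E` is a set of unique differentiability (`T > 0`). [folklore] -/
theorem uniqueDiffOn_slab (hT : 0 < T) : UniqueDiffOn ℝ (Icc 0 T ×ˢ (univ : Set (EuclideanSpace ℝ ι))) :=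
  (uniqueDiffOn_Icc hT).prod uniqueDiffOn_univ

/-- The directional derivatives within the slab are synthesized fields:
`fderivWithin (synth W) slab z y = y.1 • synth (W₁, …) z + synth (dmul y.2 W) z`. [folklore] -/
theorem fderivWithin_synth_apply (hT : 0 < T) (hW : IsFourierFamily T (n + 1) W)
    {z : ℝ × EuclideanSpace ℝ ι} (hz : z ∈ Icc 0 T ×ˢ univ) (y : ℝ × EuclideanSpace ℝ ι) :
    fderivWithin ℝ (synth W) (Icc 0 T ×ˢ univ) z y =
      (y.1 : ℂ) * synth (fun k => W (k + 1)) z + synth (dmul y.2 W) z := by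
  obtain ⟨L, hL, hLy⟩ := hasFDerivWithinAt_synth hT hW hz
  rw [hL.fderivWithin (uniqueDiffOn_slab hT z hz), hLy]

/-- Differentiability of the synthesized field on the slab for families of order `≥ 1`. [folklore] -/
theorem differentiableOn_synth (hT : 0 < T) (hW : IsFourierFamily T (n + 1) W) :
    DifferentiableOn ℝ (synth W) (Icc 0 T ×ˢ univ) := fun _ hz =>
  (hasFDerivWithinAt_synth hT hW hz).choose_spec.1.differentiableWithinAt

/-- **Joint `C^n` smoothness of the synthesized field on the closed slab**, for every Fourier
family of order `n` (induction on `n` via `contDiffOn_succ_iff_fderiv_apply`; the derivatives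
are synthesized fields of the shifted and symbol-multiplied families). [folklore] -/
theorem contDiffOn_synth (hT : 0 < T) :
    ∀ (n : ℕ) (W : ℕ → ℝ → EuclideanSpace ℝ ι → ℂ), IsFourierFamily T n W →
      ContDiffOn ℝ n (synth W) (Icc 0 T ×ˢ univ) := by
  intro n
  induction n with
  | zero =>
    intro W hW
    rw [Nat.cast_zero, contDiffOn_zero]
    exact continuousOn_synth hW
  | succ n ih =>
    intro W hW
    rw [Nat.cast_succ]
    refine contDiffOn_succ_of_fderiv_apply (differentiableOn_synth hT hW) (fun h => ?_) fun y => ?_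
    · exact absurd h (by simp)
    · have h1 : ContDiffOn ℝ n (synth (fun k => W (k + 1))) (Icc 0 T ×ˢ univ) := ih _ hW.shift
      have h2 : ContDiffOn ℝ n (synth (dmul y.2 W)) (Icc 0 T ×ˢ univ) :=
        ih _ ((hW.dmul y.2).mono (Nat.le_succ n))
      have h3 : ContDiffOn ℝ n (fun z => (y.1 : ℂ) * synth (fun k => W (k + 1)) z +
          synth (dmul y.2 W) z) (Icc 0 T ×ˢ univ) := (contDiffOn_const.mul h1).add h2
      exact h3.congr fun z hz => fderivWithin_synth_apply hT hW hz y

/-- **`C^∞` smoothness**: if `W₀` is the zeroth member of a Fourier family of every order, then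
`(t, x) ↦ 𝓕 (W₀ t) x` is `C^∞` on the closed slab. [folklore] -/
theorem contDiffOn_synth_infty (hT : 0 < T) {W₀ : ℝ → EuclideanSpace ℝ ι → ℂ}
    (hall : ∀ n : ℕ, ∃ W : ℕ → ℝ → EuclideanSpace ℝ ι → ℂ, W 0 = W₀ ∧ IsFourierFamily T n W) :
    ContDiffOn ℝ ∞ (fun z : ℝ × EuclideanSpace ℝ ι => 𝓕 (W₀ z.1) z.2) (Icc 0 T ×ˢ univ) := by
  rw [contDiffOn_infty]
  intro n
  obtain ⟨W, hW0, hW⟩ := hall n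
  have h1 := contDiffOn_synth hT n W hW
  have h2 : synth W = fun z : ℝ × EuclideanSpace ℝ ι => 𝓕 (W₀ z.1) z.2 := by
    funext z; rw [synth, hW0]
  rw [h2] at h1
  exact h1

/-- **The time derivative within `[0, T]`** of the synthesized field at a fixed point `x`:
`∂ₜ synth W (t, x) = synth (W₁, …) (t, x)`. [folklore] -/
theorem hasDerivWithinAt_synth_time (hT : 0 < T) (hW : IsFourierFamily T (n + 1) W)
    (x : EuclideanSpace ℝ ι) {t : ℝ} (ht : t ∈ Icc 0 T) :
    HasDerivWithinAt (fun s => synth W (s, x)) (synth (fun k => W (k + 1)) (t, x)) (Icc 0 T) t := by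
  have hz : ((t, x) : ℝ × EuclideanSpace ℝ ι) ∈ Icc 0 T ×ˢ (univ : Set (EuclideanSpace ℝ ι)) :=
    mk_mem_prod ht (mem_univ x)
  obtain ⟨L, hL, hLy⟩ := hasFDerivWithinAt_synth hT hW hz
  have hγ : HasDerivWithinAt (fun s : ℝ => ((s, x) : ℝ × EuclideanSpace ℝ ι))
      ((1, 0) : ℝ × EuclideanSpace ℝ ι) (Icc 0 T) t :=
    (hasDerivWithinAt_id t _).prodMk (hasDerivWithinAt_const _ _ _)
  have h := hL.comp_hasDerivWithinAt t hγ (fun s hs => mk_mem_prod hs (mem_univ _))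
  have hval : L (1, 0) = synth (fun k => W (k + 1)) (t, x) := by
    rw [hLy]; simp [synth_dmul_zero]
  rw [hval] at h
  exact h

end Literature.Analysis.FluidPDE.FourierNS

end
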